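import Summits.PneNP.PneNP.Theorems.BISOrderDimensionIdealVerifier
import Literature.Computability.Complexity.StockmeyerMachines
import Literature.Computability.Complexity.OracleEmpty
import Literature.Computability.Complexity.OracleEmptyFP
import Literature.Computability.Complexity.GuardedBallStages
import Literature.Computability.Cryptography.OneWayFunctionsPneNP

/-!
# Route BISOrderDimension — `Assembly` (stmt-PneNP-2098)

`IdealsNoFPRAS → PneNP`. If `¬PneNP` then `NP ⊆ P`; the ideal-indicator relation `R` is in `P = P^∅`
(`BISOrderDimensionIdealVerifier`, `PRel_empty_holds`), so Stockmeyer's approximate counting at the EMPTY oracle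
(`stockmeyerApproxCounting_holds`, proved) gives `L ∈ NP^∅ = NP ⊆ P` (`NPRel_empty`) and a counter `F ∈ FP^L ⊆ FP`
(`ofLanguage_mem_FP_of_mem_P`, `FPRel_subset_FP_of_mem_FP`) for `countWitnesses R m x` at every witness length `m`; shifting the
query to `m = n_x` (the dimension of the matrix decoded from `x`, `0` if `x` does not decode) and truncating the coins to the
length `F` expects (cylinder events, `uniformProb_take_of_le`) is an `FP` transducer whose answers approximate
`countWitnesses R n_x x = #IDEALS(x)` — the FPRAS that `IdealsNoFPRAS` denies.
-/

set_option linter.dupNamespace false -- `Summit.PneNP.PneNP.…`: summit = sub-problem name (D-0017 single-conjunct layout)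

namespace Summit.PneNP.PneNP.Theorems

open _root_.Computability Polynomial
open Literature.Computability.Complexity Literature.Computability.Complexity.CodeFP
  Literature.Computability.Complexity.Brick

/-- **The shifted, truncated counter is polynomial time**: `⟨⟨x, ⟨1⁰, P⟩⟩, u⟩ ↦ F ⟨⟨x, ⟨1^{m(x)}, P⟩⟩, u↾c(|x|+m(x)+|P₁|+|P₂|)⟩`
with `m(x) = min(n_x, |x|)` if `x` decodes (entry list of length `n_x²`) and `0` otherwise. [cite: AroraBarakCC2009, §1.3] [folklore] -/
theorem bisOrderDimension_shiftCounter_mem_FP {F : List Bool → List Bool} (hF : F ∈ FP) (c : Polynomial ℕ) :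
    (fun w : List Bool => F (boolPair (boolPair (fstF (fstF w)) (boolPair (unaryEncodeNat
        (if decide ((NegCNF.decList decodeNat (boolUnpair (sndF (fstF (fstF w)))).1.length (boolUnpair (sndF (fstF (fstF w)))).2).length =
            decodeNat (fstF (fstF (fstF w))) * decodeNat (fstF (fstF (fstF w)))) then min (decodeNat (fstF (fstF (fstF w)))) (fstF (fstF w)).length else 0))
        (sndF (sndF (fstF w)))))
      ((sndF w).take (c.eval ((fstF (fstF w)).length +
        (if decide ((NegCNF.decList decodeNat (boolUnpair (sndF (fstF (fstF w)))).1.length (boolUnpair (sndF (fstF (fstF w)))).2).length =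
            decodeNat (fstF (fstF (fstF w))) * decodeNat (fstF (fstF (fstF w)))) then min (decodeNat (fstF (fstF (fstF w)))) (fstF (fstF w)).length else 0) +
        (fstF (sndF (sndF (fstF w)))).length + (sndF (sndF (sndF (fstF w)))).length))))) ∈ FP := by
  have hfst : CodeFP strE strE fun w : List Bool => fstF w := CodeFP.of_fn fstF fstF_mem_FP fun _ => rfl
  have hsnd : CodeFP strE strE fun w : List Bool => sndF w := CodeFP.of_fn sndF sndF_mem_FP fun _ => rfl
  have hdec : CodeFP strE natE fun w : List Bool => decodeNat w := CodeFP.of_fn canonF canonF_mem_FP canonF_eq_encodeNat_decodeNat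
  have hlistC : CodeFP strE (listE natE) fun c : List Bool => NegCNF.decList decodeNat (boolUnpair c).1.length (boolUnpair c).2 :=
    CodeFP.of_fn (CanonCode.canonListFnC 2 canonF) (CanonCode.canonListFnC_mem_FP 2 canonF_mem_FP) fun c =>
      (bisOrderDimension_listDecode c).2.trans (congrFun (listE_eq encodingNatBool) _)
  have hX : CodeFP strE strE fun w : List Bool => fstF (fstF w) := (hfst.comp hfst :)
  have hn : CodeFP strE natE fun w : List Bool => decodeNat (fstF (fstF (fstF w))) := (hdec.comp (hfst.comp hX) :)
  have hL : CodeFP strE (rawE natE) fun w : List Bool =>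
      NegCNF.decList decodeNat (boolUnpair (sndF (fstF (fstF w)))).1.length (boolUnpair (sndF (fstF (fstF w)))).2 :=
    ((rawOfList natE).comp (hlistC.comp (hsnd.comp hX)) :)
  have hlenL := ((natLength natE).comp hL :)
  have hnn := (natMul.comp (hn.pair hn) :)
  have htest := (natEq.comp (hlenL.pair hnn) :)
  have hmin : CodeFP strE unE fun w : List Bool => min (decodeNat (fstF (fstF (fstF w)))) (fstF (fstF w)).length :=
    (unOfNatMin.comp ((strLength.comp hX).pair hn) :)
  have hmU : CodeFP strE unE fun w : List Bool =>
      if decide ((NegCNF.decList decodeNat (boolUnpair (sndF (fstF (fstF w)))).1.length (boolUnpair (sndF (fstF (fstF w)))).2).length =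
          decodeNat (fstF (fstF (fstF w))) * decodeNat (fstF (fstF (fstF w)))) then min (decodeNat (fstF (fstF (fstF w)))) (fstF (fstF w)).length else 0 :=
    htest.ite hmin (CodeFP.const _ 0)
  have hPP : CodeFP strE strE fun w : List Bool => sndF (sndF (fstF w)) := (hsnd.comp (hsnd.comp hfst) :)
  have hA : CodeFP strE unE fun w : List Bool => (fstF (sndF (sndF (fstF w)))).length := (strLength.comp (hfst.comp hPP) :)
  have hB : CodeFP strE unE fun w : List Bool => (sndF (sndF (sndF (fstF w)))).length := (strLength.comp (hsnd.comp hPP) :)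
  have hN := ((Literature.Computability.MetaComplexity.GSTRefuter.codeFP_unPoly c).comp
    (unAdd.comp ((unAdd.comp ((unAdd.comp ((strLength.comp hX).pair hmU)).pair hA)).pair hB)) :)
  have htake := (strTake.comp (hN.pair hsnd) :)
  have hF4 : CodeFP (pairE (pairE strE (pairE unE strE)) strE) strE fun t : (List Bool × (ℕ × List Bool)) × List Bool =>
      F (boolPair (boolPair t.1.1 (boolPair (unaryEncodeNat t.1.2.1) t.1.2.2)) t.2) := ⟨F, hF, fun _ => rfl⟩
  obtain ⟨F', hF', hspec⟩ := (hF4.comp ((hX.pair (hmU.pair hPP)).pair htake) :)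
  convert hF' using 1
  funext w
  exact (hspec w).symm

/-- **`Assembly` (stmt-PneNP-2098)**: `IdealsNoFPRAS → PneNP`, by Stockmeyer's approximate counting at the empty oracle under
`NP ⊆ P`. [cite: Stockmeyer1985] [cite: AaronsonArkhipovToC2013, Thm. 4.1 (p. 175)] -/
theorem bisOrderDimension_assembly_proof : Summit.PneNP.PneNP.Theses.BISOrderDimension.Assembly := by
  classical
  intro hX
  by_contra hne
  have hNP : Nondeterministic.NP ⊆ Classes.P := by
    by_contra h
    exact hne (Literature.Computability.Cryptography.pneNP_shape_of_NP_not_subset_P h)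
  obtain ⟨R, hRP, hRiff⟩ := bisOrderDimension_exists_idealRel
  have hRrel : R ∈ PRel Oracle.empty := by
    rw [show PRel Oracle.empty = Classes.P from PRel_empty_holds]; exact hRP
  obtain ⟨Lo, hLo, F, hF, c, hc⟩ := StockMachine.stockmeyerApproxCounting_holds Oracle.empty R hRrel
  have hLoP : Lo ∈ Classes.P := hNP (by rw [← NPRel_empty]; exact hLo)
  have hFFP : F ∈ FP := FPRel_subset_FP_of_mem_FP (GuardedBall.ofLanguage_mem_FP_of_mem_P hLoP) hF
  apply hX
  refine ⟨_, bisOrderDimension_shiftCounter_mem_FP hFFP c, c.comp (X + X), fun x kη kδ hη hδ => ?_⟩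
  -- the data of `x`
  set n := decodeNat (fstF x) with hn
  set L := NegCNF.decList decodeNat (boolUnpair (sndF x)).1.length (boolUnpair (sndF x)).2 with hL
  set m := (if decide (L.length = n * n) then min n x.length else 0) with hm
  have hmle : m ≤ x.length := by
    rw [hm]; split_ifs
    · exact min_le_right _ _
    · exact Nat.zero_le _
  have hunary : ∀ k : ℕ, (unaryEncodeNat k).length = k := length_unE
  -- the value of the new counter on a query
  have hval : ∀ u : List Bool, countEstimate (fun w : List Bool => F (boolPair (boolPair (fstF (fstF w)) (boolPair (unaryEncodeNat
        (if decide ((NegCNF.decList decodeNat (boolUnpair (sndF (fstF (fstF w)))).1.length (boolUnpair (sndF (fstF (fstF w)))).2).length =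
            decodeNat (fstF (fstF (fstF w))) * decodeNat (fstF (fstF (fstF w)))) then min (decodeNat (fstF (fstF (fstF w)))) (fstF (fstF w)).length else 0))
        (sndF (sndF (fstF w)))))
      ((sndF w).take (c.eval ((fstF (fstF w)).length +
        (if decide ((NegCNF.decList decodeNat (boolUnpair (sndF (fstF (fstF w)))).1.length (boolUnpair (sndF (fstF (fstF w)))).2).length =
            decodeNat (fstF (fstF (fstF w))) * decodeNat (fstF (fstF (fstF w)))) then min (decodeNat (fstF (fstF (fstF w)))) (fstF (fstF w)).length else 0) +
        (fstF (sndF (sndF (fstF w)))).length + (sndF (sndF (sndF (fstF w)))).length))))) x 0 kη kδ u =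
      countEstimate F x m kη kδ (u.take (c.eval (x.length + m + kη + kδ))) := by
    intro u
    simp only [countEstimate_def, countQuery, fstF_boolPair, sndF_boolPair, hunary, ← hn, ← hL, ← hm]
  -- the count identity
  have hLle : L.length ≤ x.length := by
    rw [hL, NegCNF.length_decList]
    have h1 := length_boolUnpair_parts_le (sndF x)
    have h2 := length_boolUnpair_parts_le x
    have h3 : (sndF x).length = (boolUnpair x).2.length := rfl
    omega
  have hcount : countWitnesses R m x = (encodingNatMatrix.decode x).elim 0
      fun p => Set.ncard {I : Finset (Fin p.1) | ∀ i ∈ I, ∀ j : Fin p.1, p.2 i j ≠ 0 → j ∈ I} := by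
    by_cases hd : L.length = n * n
    · have hnle : n ≤ x.length := by
        rcases Nat.eq_zero_or_pos n with h0 | hpos
        · rw [h0]; exact Nat.zero_le _
        · calc n ≤ n * n := Nat.le_mul_of_pos_left n hpos
            _ = L.length := hd.symm
            _ ≤ x.length := hLle
      have hmin : min n x.length = n := min_eq_left hnle
      have hmn : m = n := by rw [hm, decide_eq_true hd, if_pos rfl, hmin]
      rw [hmn, bisOrderDimension_countWitnesses_eq R hRiff x hd hmin, bisOrderDimension_decode_some x hd]
      rfl
    · have hm0 : m = 0 := by rw [hm]; simp [hd]
      rw [hm0, bisOrderDimension_decode_none x hd]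
      change _ = 0
      unfold countWitnesses
      refine Finset.card_eq_zero.2 (Finset.filter_eq_empty_iff.2 fun y _ h => hd ((hRiff x _).1 h).1)
  -- the coin budget and the cylinder event
  have hle : c.eval (x.length + m + kη + kδ) ≤ (c.comp (X + X)).eval (x.length + kη + kδ) := by
    rw [eval_comp, eval_add, eval_X]
    exact TM2Iter.eval_mono c (by omega)
  have hc' := hc x m kη kδ hη hδ
  rw [← uniformProb_take_of_le hle] at hc'
  convert hc' using 2
  ext u
  simp only [Set.mem_setOf_eq]
  rw [hval u, hcount]

end Summit.PneNP.PneNP.Theorems
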